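import Mathlib
import HarnessLib
import Summits.QuantumFields.YangMills.Theorems.LangevinControlUVOSLegsFromFemtoAndGapStubAssemblyUniformBoundPrep
import Summits.QuantumFields.YangMills.Theorems.LangevinControlUVOSLegsFromFemtoAndGapStubAssemblyLatticeSums
import Summits.QuantumFields.YangMills.Theorems.ContinuumLimitExists.Negative.OvercooledUUVB

/-!
# `ContinuumLegGivenGap` (stmt-QuantumFields-15828), line `alternating-curvature-arrays`: `stub_productToUniform`, helper P2 — the near-diagonal regime, uniformly in the spacing

Support file for the Whitney / grid-shift / nuclear step `stub_productToUniform` ((PB) ⇒ (UUVB)) of the line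
`alternating-curvature-arrays`.  The canonical lattice distribution at step `k` is the finite atomic functional
`F ↦ ∑_{x ∈ (box L_k)^p} F(a_k x⃗) · c_k(x⃗)` with centred plaquette-string moments `|c_k(x⃗)| ≤ (12 N)^p`
(`ContinuumLimitExists.Negative.canonDistribution_obsOf_eq_sum`, `abs_centredMoment_le`).  The product bound (PB)
cannot reach lattice configurations whose closest pair is only `O((2p+1))` lattice units apart (no admissible cell
separates them with both points in cores); this file bounds that NEAR-DIAGONAL part WITHOUT (PB), uniformly in the
spacing `0 < a ≤ 1`, from the infinite-order vanishing of `F ∈ ⁰𝒮` on the fat diagonal: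

* `nearDiag_norm_apply_le` — for `F ∈ ⁰𝒮((ℝ⁴)^p)` and a configuration `x⃗ ∈ (ℤ⁴)^p` with a pair `i ≠ j` at lattice
  sup-distance `≤ R`: `‖F(a x⃗)‖ ≤ 2^{6p} (2aR)^{4p} (S_{0,4p} F + S_{6p,4p} F) ∏ᵢ ((1 + a‖xᵢ‖)⁶)⁻¹` (flatness of order
  `4p` at the coincident point `xⱼ := xᵢ`, toolkit IV `offDiagonal_pow_mul_norm_le`, with the Schwartz weight `(1+‖y‖)^{6p}`
  traded for the product weight);
* `nearDiag_sum_norm_le` (registered anchor) — summed over ANY finite family of such configurations: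
  `∑ ‖F(a x⃗)‖ ≤ (1024 K₀ R⁴)^p (S_{0,4p} F + S_{6p,4p} F)`, `K₀ = 81 ∑ₘ (m+1)⁻²` (toolkit V `sum_prod_decay_le`: the
  factor `a^{4p}` of flatness pays exactly the `a^{-4p}` of the site count) — NO dependence on `a` or on the volume;
* `nearDiag_canonDistribution_part_le` — hence the near-diagonal part of a canonical plaquette-string distribution is
  at most `(12 N)^p (1024 K₀ R⁴)^p (S_{0,4p} F + S_{6p,4p} F) ≤ 2 (12288 N K₀ R⁴)^p |F|_{6p}`
  (`nearDiag_canonDistribution_part_le_schwartzNorm`): the shape `α^p · |F|_{p s}` of (UUVB) with `s = 6`.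

References: Osterwalder–Schrader 1975 §2 (`⁰𝒮`, E0′); Glimm–Jaffe 1987 §6.1.  Mathlib + landed tree lemmas only; no
definitions. [folklore]
-/

set_option autoImplicit false

noncomputable section

namespace Summit.QuantumFields.YangMills.Theorems.ContinuumLegGivenGap

open scoped SchwartzMap BigOperators
open MeasureTheory Filter Topology
open Literature.MathematicalPhysics.QuantumFieldTheory Literature.MathematicalPhysics.QuantumLattice
  Literature.MathematicalPhysics.AQFT
open Literature.Probability.LatticeModels (box Site)
open Summit.QuantumFields.YangMills.Cruxes.ContinuumLimitOnTrajectory.TwoOrbitSynchronisation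
  (PlaqIdx plaq canonDistribution)
open Summit.QuantumFields.YangMills.Theorems.OSLegsFromFemtoAndGap
  (offDiagonal_pow_mul_norm_le norm_smul_siteToE_sub_le mul_norm_le_norm_smul_siteToE norm_mul_one_add_pow_le
    inv_one_add_norm_pow_le_prod sum_prod_decay_le summable_inv_succ_sq)
open Summit.QuantumFields.YangMills.Theorems.ContinuumLimitExists.Negative
  (obsOf centredMoment abs_centredMoment_le canonDistribution_obsOf_eq_sum)

/-! ## §1 One near-diagonal configuration -/

/-- **Pointwise near-diagonal bound.** For `F ∈ ⁰𝒮((ℝ⁴)^p)`, spacing `a ≥ 0` and a lattice configuration `x⃗` with a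
pair `i ≠ j` at sup-distance `≤ R`: `‖F(a x⃗)‖ ≤ 2^{6p} (2aR)^{4p} (S_{0,4p} F + S_{6p,4p} F) · ∏ᵢ ((1 + a‖xᵢ‖)⁶)⁻¹`.
[folklore] -/
theorem nearDiag_norm_apply_le {p : ℕ} (F : 𝓢((Fin p → (EuclideanSpace ℝ (Fin 4))), ℂ)) (hF : IsOffDiagonal F) {a : ℝ} (ha : 0 ≤ a)
    {R : ℝ} (hR : 0 ≤ R) (x : Fin p → Site 4) {i j : Fin p} (hij : i ≠ j) (hx : ‖x i - x j‖ ≤ R) :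
    ‖F (fun l => a • siteToE (x l))‖ ≤
      2 ^ (6 * p) * ((2 * a * R) ^ (4 * p) *
        (SchwartzMap.seminorm ℂ 0 (4 * p) F + SchwartzMap.seminorm ℂ (6 * p) (4 * p) F)) *
        ∏ l, ((1 + a * ‖x l‖) ^ 6)⁻¹ := by
  set y : Fin p → (EuclideanSpace ℝ (Fin 4)) := fun l => a • siteToE (x l) with hy
  -- the close pair in physical units
  have hpair : ‖y i - y j‖ ≤ 2 * a * R :=
    (norm_smul_siteToE_sub_le ha (x i) (x j)).trans (by nlinarith)
  have hpow : ‖y i - y j‖ ^ (4 * p) ≤ (2 * a * R) ^ (4 * p) := pow_le_pow_left₀ (norm_nonneg _) hpair _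
  -- flatness of order `4p`, without and with the weight `‖y‖^{6p}`
  have hA : ‖F y‖ ≤ SchwartzMap.seminorm ℂ 0 (4 * p) F * (2 * a * R) ^ (4 * p) := by
    have h := offDiagonal_pow_mul_norm_le F hF 0 (4 * p) hij y
    rw [pow_zero, one_mul] at h
    exact h.trans (mul_le_mul_of_nonneg_left hpow (apply_nonneg _ _))
  have hB : ‖y‖ ^ (6 * p) * ‖F y‖ ≤ SchwartzMap.seminorm ℂ (6 * p) (4 * p) F * (2 * a * R) ^ (4 * p) :=
    (offDiagonal_pow_mul_norm_le F hF (6 * p) (4 * p) hij y).trans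
      (mul_le_mul_of_nonneg_left hpow (apply_nonneg _ _))
  have hAB := norm_mul_one_add_pow_le hA hB
  -- move the weight to the right-hand side and split it over the points
  have hwpos : 0 < (1 + ‖y‖) ^ (6 * p) := by positivity
  have h1 : ‖F y‖ ≤ 2 ^ (6 * p) * ((2 * a * R) ^ (4 * p) *
      (SchwartzMap.seminorm ℂ 0 (4 * p) F + SchwartzMap.seminorm ℂ (6 * p) (4 * p) F)) *
      ((1 + ‖y‖) ^ (6 * p))⁻¹ := by
    rw [← div_eq_mul_inv, le_div_iff₀ hwpos]
    calc ‖F y‖ * (1 + ‖y‖) ^ (6 * p)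
        ≤ 2 ^ (6 * p) * (SchwartzMap.seminorm ℂ 0 (4 * p) F * (2 * a * R) ^ (4 * p) +
            SchwartzMap.seminorm ℂ (6 * p) (4 * p) F * (2 * a * R) ^ (4 * p)) := hAB
      _ = _ := by ring
  have h2 : ((1 + ‖y‖) ^ (6 * p))⁻¹ ≤ ∏ l, ((1 + a * ‖x l‖) ^ 6)⁻¹ := by
    have h := inv_one_add_norm_pow_le_prod ha x y (fun l => mul_norm_le_norm_smul_siteToE ha (x l)) 6
    rwa [← inv_pow, ← pow_mul, inv_pow] at h
  exact h1.trans (mul_le_mul_of_nonneg_left h2 (by positivity))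

/-! ## §2 Summing over near-diagonal configurations -/

/-- The weights `∏ᵢ ((1 + a‖xᵢ‖)⁶)⁻¹` summed over ANY finite family of distinct configurations are at most
`a^{-4p} K₀^p`, `K₀ = 81 ∑ₘ (m+1)⁻²` (`0 < a ≤ 1`). [folklore] -/
theorem nearDiag_sum_weights_le {p : ℕ} {a : ℝ} (ha : 0 < a) (ha1 : a ≤ 1) {ι : Type*} (s : Finset ι)
    (x : ι → Fin p → Site 4) (hinj : Set.InjOn x s) :
    ∑ c ∈ s, ∏ l, ((1 + a * ‖x c l‖) ^ 6)⁻¹ ≤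
      (a ^ 4)⁻¹ ^ p * (81 * ∑' m : ℕ, (((m : ℝ) + 1) ^ 2)⁻¹) ^ p := by
  classical
  -- all coordinates of all configurations
  set T : Finset (Site 4) := s.biUnion fun c => Finset.univ.image (x c) with hT
  have hsub : s.image x ⊆ Fintype.piFinset fun _ : Fin p => T := by
    intro z hz
    rw [Finset.mem_image] at hz
    obtain ⟨c, hc, rfl⟩ := hz
    rw [Fintype.mem_piFinset]
    intro l
    exact Finset.mem_biUnion.2 ⟨c, hc, Finset.mem_image.2 ⟨l, Finset.mem_univ _, rfl⟩⟩
  have hw : ∀ z : Fin p → Site 4, ∏ l, ((1 + a * ‖z l‖) ^ 6)⁻¹ =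
      (a ^ 4)⁻¹ ^ p * ∏ l, (a ^ 4 * ((1 + a * ‖z l‖) ^ 6)⁻¹) := fun z => by
    rw [Finset.prod_mul_distrib, Finset.prod_const, Finset.card_univ, Fintype.card_fin, ← mul_assoc,
      ← mul_pow, inv_mul_cancel₀ (pow_ne_zero 4 ha.ne'), one_pow, one_mul]
  calc ∑ c ∈ s, ∏ l, ((1 + a * ‖x c l‖) ^ 6)⁻¹
      = ∑ z ∈ s.image x, ∏ l, ((1 + a * ‖z l‖) ^ 6)⁻¹ :=
        (Finset.sum_image (f := fun z : Fin p → Site 4 => ∏ l, ((1 + a * ‖z l‖) ^ 6)⁻¹) hinj).symm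
    _ ≤ ∑ z ∈ Fintype.piFinset (fun _ : Fin p => T), ∏ l, ((1 + a * ‖z l‖) ^ 6)⁻¹ :=
        Finset.sum_le_sum_of_subset_of_nonneg hsub fun z _ _ => by positivity
    _ = (a ^ 4)⁻¹ ^ p * ∑ z ∈ Fintype.piFinset (fun _ : Fin p => T), ∏ l, (a ^ 4 * ((1 + a * ‖z l‖) ^ 6)⁻¹) := by
        rw [Finset.mul_sum]
        exact Finset.sum_congr rfl fun z _ => hw z
    _ ≤ (a ^ 4)⁻¹ ^ p * (81 * ∑' m : ℕ, (((m : ℝ) + 1) ^ 2)⁻¹) ^ p :=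
        mul_le_mul_of_nonneg_left (sum_prod_decay_le ha ha1 (le_refl 6) T p) (by positivity)

/-- **Near-diagonal lattice sums of `⁰𝒮` functions, uniformly in the spacing** (registered anchor).  For
`F ∈ ⁰𝒮((ℝ⁴)^p)`, `0 < a ≤ 1`, `R ≥ 0` and any finite family of DISTINCT lattice configurations each having a pair of
points at sup-distance `≤ R`:
`∑ ‖F(a x⃗)‖ ≤ (1024 K₀ R⁴)^p (S_{0,4p} F + S_{6p,4p} F)`, `K₀ = 81 ∑ₘ (m+1)⁻²` — independent of `a` and of the family.
[folklore] -/
theorem nearDiag_sum_norm_le : ∀ (p : ℕ) (F : 𝓢((Fin p → EuclideanSpace ℝ (Fin 4)), ℂ)), IsOffDiagonal F →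
    ∀ (a R : ℝ), 0 < a → a ≤ 1 → 0 ≤ R → ∀ (ι : Type) (s : Finset ι) (x : ι → Fin p → Fin 4 → ℤ), Set.InjOn x s →
    (∀ c ∈ s, ∃ i j : Fin p, i ≠ j ∧ ‖x c i - x c j‖ ≤ R) →
    ∑ c ∈ s, ‖F (fun l => a • siteToE (x c l))‖ ≤
      (1024 * (81 * ∑' m : ℕ, (((m : ℝ) + 1) ^ 2)⁻¹) * R ^ 4) ^ p *
        (SchwartzMap.seminorm ℂ 0 (4 * p) F + SchwartzMap.seminorm ℂ (6 * p) (4 * p) F) := by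
  intro p F hF a R ha ha1 hR ι s x hinj hs
  set K₀ : ℝ := 81 * ∑' m : ℕ, (((m : ℝ) + 1) ^ 2)⁻¹ with hK₀
  set S : ℝ := SchwartzMap.seminorm ℂ 0 (4 * p) F + SchwartzMap.seminorm ℂ (6 * p) (4 * p) F with hS
  have hS0 : 0 ≤ S := add_nonneg (apply_nonneg _ _) (apply_nonneg _ _)
  have hK0 : 0 ≤ K₀ := mul_nonneg (by norm_num) (tsum_nonneg fun m => by positivity)
  -- pointwise bound, then the weight sum
  have hpt : ∀ c ∈ s, ‖F (fun l => a • siteToE (x c l))‖ ≤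
      2 ^ (6 * p) * ((2 * a * R) ^ (4 * p) * S) * ∏ l, ((1 + a * ‖x c l‖) ^ 6)⁻¹ := fun c hc => by
    obtain ⟨i, j, hij, hxij⟩ := hs c hc
    exact nearDiag_norm_apply_le F hF ha.le hR (x c) hij hxij
  calc ∑ c ∈ s, ‖F (fun l => a • siteToE (x c l))‖
      ≤ ∑ c ∈ s, 2 ^ (6 * p) * ((2 * a * R) ^ (4 * p) * S) * ∏ l, ((1 + a * ‖x c l‖) ^ 6)⁻¹ :=
        Finset.sum_le_sum hpt
    _ = 2 ^ (6 * p) * ((2 * a * R) ^ (4 * p) * S) * ∑ c ∈ s, ∏ l, ((1 + a * ‖x c l‖) ^ 6)⁻¹ := by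
        rw [Finset.mul_sum]
    _ ≤ 2 ^ (6 * p) * ((2 * a * R) ^ (4 * p) * S) * ((a ^ 4)⁻¹ ^ p * K₀ ^ p) :=
        mul_le_mul_of_nonneg_left (nearDiag_sum_weights_le ha ha1 s x hinj) (by positivity)
    _ = (1024 * K₀ * R ^ 4) ^ p * S := by
        have ha4 : a ^ 4 ≠ 0 := pow_ne_zero 4 ha.ne'
        have hnum : (1024 : ℝ) ^ p = 2 ^ (6 * p) * 2 ^ (4 * p) := by
          rw [pow_mul, pow_mul, ← mul_pow]; norm_num
        have ha4p : a ^ (4 * p) * (a ^ 4)⁻¹ ^ p = 1 := by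
          rw [pow_mul, ← mul_pow, mul_inv_cancel₀ ha4, one_pow]
        simp only [mul_pow]
        rw [hnum]
        linear_combination ((2 : ℝ) ^ (6 * p) * 2 ^ (4 * p) * R ^ (4 * p) * S * K₀ ^ p) * ha4p

/-! ## §3 The near-diagonal part of a canonical plaquette-string distribution -/

section Canon

variable {G : Type} [Group G] [TopologicalSpace G] [IsTopologicalGroup G] [CompactSpace G]
  [MeasurableSpace G] [BorelSpace G]

/-- The lattice-sum form of the canonical distribution of a PLAQUETTE string (the alphabet letter `some q` of
`ContinuumLimitExists.Negative.obsOf` is `plaq r q`). [folklore] -/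
theorem nearDiag_canonDistribution_eq_sum (r : LatticeRep G) (sch : SpeciesScheme (YMSpecies G)) (k p : ℕ)
    (q : Fin p → PlaqIdx) (F : 𝓢((Fin p → (EuclideanSpace ℝ (Fin 4))), ℂ)) :
    canonDistribution r sch k p (fun i => plaq r (q i)) F =
      ∑ x : Fin p → ↥(box 4 (sch.L k)), F (fun i => sch.a k • siteToE (↑(x i) : Site 4)) *
        ((centredMoment r (sch.L k) (sch.β k) p (fun i => some (q i)) (fun i => (x i : Site 4)) : ℝ) : ℂ) :=
  canonDistribution_obsOf_eq_sum r sch k p (fun i => some (q i)) F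

/-- **The near-diagonal part of a canonical plaquette-string distribution**, uniformly in `k` once `a_k ≤ 1`: for any
finite family `s` of box configurations each with a pair at lattice sup-distance `≤ R`,
`‖∑_{x ∈ s} F(a_k x⃗) c_k(x⃗)‖ ≤ (12 N)^p (1024 K₀ R⁴)^p (S_{0,4p} F + S_{6p,4p} F)`. [folklore] -/
theorem nearDiag_canonDistribution_part_le (r : LatticeRep G) (sch : SpeciesScheme (YMSpecies G)) (k p : ℕ)
    (q : Fin p → PlaqIdx) (F : 𝓢((Fin p → (EuclideanSpace ℝ (Fin 4))), ℂ)) (hF : IsOffDiagonal F) (ha1 : sch.a k ≤ 1) {R : ℝ} (hR : 0 ≤ R)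
    (s : Finset (Fin p → ↥(box 4 (sch.L k))))
    (hs : ∀ x ∈ s, ∃ i j : Fin p, i ≠ j ∧ ‖(↑(x i) : Site 4) - ↑(x j)‖ ≤ R) :
    ‖∑ x ∈ s, F (fun i => sch.a k • siteToE (↑(x i) : Site 4)) *
        ((centredMoment r (sch.L k) (sch.β k) p (fun i => some (q i)) (fun i => (x i : Site 4)) : ℝ) : ℂ)‖ ≤
      (12 * (r.N : ℝ)) ^ p * ((1024 * (81 * ∑' m : ℕ, (((m : ℝ) + 1) ^ 2)⁻¹) * R ^ 4) ^ p *
        (SchwartzMap.seminorm ℂ 0 (4 * p) F + SchwartzMap.seminorm ℂ (6 * p) (4 * p) F)) := by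
  -- the embedding of box configurations into lattice configurations is injective
  set x : (Fin p → ↥(box 4 (sch.L k))) → Fin p → Site 4 := fun c i => (c i : Site 4) with hx
  have hinj : Set.InjOn x s := fun c _ c' _ h => funext fun i => Subtype.ext (congrFun h i)
  have hsum := nearDiag_sum_norm_le p F hF (sch.a k) R (sch.a_pos k) ha1 hR _ s x hinj
    (fun c hc => hs c hc)
  calc ‖∑ c ∈ s, F (fun i => sch.a k • siteToE (↑(c i) : Site 4)) *
          ((centredMoment r (sch.L k) (sch.β k) p (fun i => some (q i)) (fun i => (c i : Site 4)) : ℝ) : ℂ)‖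
      ≤ ∑ c ∈ s, ‖F (fun i => sch.a k • siteToE (↑(c i) : Site 4)) *
          ((centredMoment r (sch.L k) (sch.β k) p (fun i => some (q i)) (fun i => (c i : Site 4)) : ℝ) : ℂ)‖ :=
        norm_sum_le _ _
    _ ≤ ∑ c ∈ s, ‖F (fun i => sch.a k • siteToE (↑(c i) : Site 4))‖ * (12 * (r.N : ℝ)) ^ p :=
        Finset.sum_le_sum fun c _ => by
          rw [norm_mul, Complex.norm_real, Real.norm_eq_abs]
          exact mul_le_mul_of_nonneg_left (abs_centredMoment_le r _ _ p _ _) (norm_nonneg _)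
    _ = (12 * (r.N : ℝ)) ^ p * ∑ c ∈ s, ‖F (fun i => sch.a k • siteToE (x c i))‖ := by
        rw [← Finset.sum_mul, mul_comm]
    _ ≤ _ := mul_le_mul_of_nonneg_left hsum (by positivity)

/-- The same bound in the currency of (UUVB): both Schwartz seminorms are dominated by `|F|_{6p} = schwartzNorm (p * 6) F`,
so the near-diagonal part is at most `2 · (12 N · 1024 K₀ R⁴)^p · |F|_{p·6}`. [folklore] -/
theorem nearDiag_canonDistribution_part_le_schwartzNorm (r : LatticeRep G) (sch : SpeciesScheme (YMSpecies G))
    (k p : ℕ) (q : Fin p → PlaqIdx) (F : 𝓢((Fin p → (EuclideanSpace ℝ (Fin 4))), ℂ)) (hF : IsOffDiagonal F) (ha1 : sch.a k ≤ 1) {R : ℝ}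
    (hR : 0 ≤ R) (s : Finset (Fin p → ↥(box 4 (sch.L k))))
    (hs : ∀ x ∈ s, ∃ i j : Fin p, i ≠ j ∧ ‖(↑(x i) : Site 4) - ↑(x j)‖ ≤ R) :
    ‖∑ x ∈ s, F (fun i => sch.a k • siteToE (↑(x i) : Site 4)) *
        ((centredMoment r (sch.L k) (sch.β k) p (fun i => some (q i)) (fun i => (x i : Site 4)) : ℝ) : ℂ)‖ ≤
      2 * (12 * (r.N : ℝ) * (1024 * (81 * ∑' m : ℕ, (((m : ℝ) + 1) ^ 2)⁻¹) * R ^ 4)) ^ p *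
        schwartzNorm (p * 6) F := by
  have h := nearDiag_canonDistribution_part_le r sch k p q F hF ha1 hR s hs
  have h1 : SchwartzMap.seminorm ℂ 0 (4 * p) F ≤ schwartzNorm (p * 6) F :=
    seminorm_le_schwartzNorm (by omega) (by omega) F
  have h2 : SchwartzMap.seminorm ℂ (6 * p) (4 * p) F ≤ schwartzNorm (p * 6) F :=
    seminorm_le_schwartzNorm (by omega) (by omega) F
  have hK0 : (0 : ℝ) ≤ 1024 * (81 * ∑' m : ℕ, (((m : ℝ) + 1) ^ 2)⁻¹) * R ^ 4 :=
    mul_nonneg (mul_nonneg (by norm_num) (mul_nonneg (by norm_num) (tsum_nonneg fun m => by positivity)))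
      (by positivity)
  have hS : SchwartzMap.seminorm ℂ 0 (4 * p) F + SchwartzMap.seminorm ℂ (6 * p) (4 * p) F ≤
      2 * schwartzNorm (p * 6) F := by linarith
  have hN : (0 : ℝ) ≤ (12 * (r.N : ℝ)) ^ p := by positivity
  refine h.trans ?_
  set C : ℝ := 1024 * (81 * ∑' m : ℕ, (((m : ℝ) + 1) ^ 2)⁻¹) * R ^ 4 with hC
  calc (12 * (r.N : ℝ)) ^ p * (C ^ p *
        (SchwartzMap.seminorm ℂ 0 (4 * p) F + SchwartzMap.seminorm ℂ (6 * p) (4 * p) F))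
      ≤ (12 * (r.N : ℝ)) ^ p * (C ^ p * (2 * schwartzNorm (p * 6) F)) :=
        mul_le_mul_of_nonneg_left (mul_le_mul_of_nonneg_left hS (pow_nonneg hK0 _)) hN
    _ = _ := by ring

end Canon

end Summit.QuantumFields.YangMills.Theorems.ContinuumLegGivenGap

end
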